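import Summits.ValiantsHypothesis.ValiantsHypothesis.Theorems.LiftNullstellensatzLiftWidthPerFourCaseAZero

/-!
# Route LiftNullstellensatz — `LiftWidthPerFour` (stmt-ValiantsHypothesis-5922), CASE A:
`∂²per_4` under a general substitution killing one column of the middle rows

Helper `--supports stmt-ValiantsHypothesis-5922` (prover val-width-5922-p2 g0).  The rung-1 bridge
(`…CaseAZero.lean`) computed `κ(∂_{0j}∂_{3k} per_4)` for the one substitution `κ` killing the rows
`0, 3` and the column `0`.  The SECTION REDUCTION of the remaining cases of `stub_caseA`
(`…CaseASection.lean`) needs the same three evaluations for an ARBITRARY substitution `g` (values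
in any commutative `K`-algebra) killing the column `0` of the middle rows: `g(∂_{0j}∂_{3k} per_4) = 0`
for `j, k ≠ 0` and `g(∂_{00}∂_{3k} per_4) = g(∂_{0k}∂_{30} per_4) = g(x_{1b})g(x_{2d}) + g(x_{1d})g(x_{2b})`
(`{k,b,d} = {1,2,3}`).  Same proofs (Laplace along the deleted row/column, `pderiv_perPoly`,
`subperm_pair_pair`).  No new definitions.  VP ≠ VNP is not moved by this item.
-/

noncomputable section

open MvPolynomial Matrix Finset

namespace Summit.ValiantsHypothesis.LiftNullstellensatz

open Literature.Computability.AlgebraicComplexity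
open Literature.Computability.AlgebraicComplexity.VonZurGathen

variable {K : Type*} [Field K]

/-! ### `∂²per_4` under a substitution killing column `0` of the middle rows -/

section Substitution

variable {A : Type*} [CommRing A] [Algebra K A] (g : Fin 4 × Fin 4 → A)

/-- `g(∂_{0j} ∂_{3k} per_4) = 0` for `j, k ≠ 0` when `g` kills column `0`. [folklore] -/
theorem aeval_pderiv_pderiv_perPoly_eq_zero (hg : ∀ r, g (r, 0) = 0) {j k : Fin 4} (hj : j ≠ 0)
    (hk : k ≠ 0) : aeval g (pderiv (0, j) (pderiv (3, k) (perPoly (Fin 4) K))) = 0 := by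
  rw [pderiv_perPoly]
  have hcongr : (mvPolynomialX (Fin 4) (Fin 4) K).subperm (· ≠ k) (· ≠ (3 : Fin 4)) =
      (mvPolynomialX (Fin 4) (Fin 4) K).subperm (· ∈ Finset.univ.erase k)
        (· ∈ Finset.univ.erase (3 : Fin 4)) :=
    (mvPolynomialX (Fin 4) (Fin 4) K).subperm_congr (fun i => by simp) (fun i => by simp)
  rw [hcongr]
  by_cases hjk : j = k
  · subst hjk
    rw [pderiv_subperm_X_col _ _ (by simp), map_zero]
  rw [pderiv_subperm_X_mem _ _ (by simp) (by simp [hjk]), aeval_subperm_X]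
  exact subperm_eq_zero_of_col_zero _ _ _ 0 (by simp [hj.symm, hk.symm]) fun r _ => hg r

/-- `g(∂_{00} ∂_{3k} per_4) = g(x_{1b}) g(x_{2d}) + g(x_{1d}) g(x_{2b})` for `{k,b,d} = {1,2,3}`.
[folklore] -/
theorem aeval_pderiv_pderiv_perPoly_eq_perm {k b d : Fin 4} (hk : k ≠ 0) (hb : b ≠ 0) (hd : d ≠ 0)
    (hkb : k ≠ b) (hkd : k ≠ d) (hbd : b ≠ d) :
    aeval g (pderiv (0, 0) (pderiv (3, k) (perPoly (Fin 4) K))) =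
      g (1, b) * g (2, d) + g (1, d) * g (2, b) := by
  rw [pderiv_perPoly]
  have hcongr : (mvPolynomialX (Fin 4) (Fin 4) K).subperm (· ≠ k) (· ≠ (3 : Fin 4)) =
      (mvPolynomialX (Fin 4) (Fin 4) K).subperm (· ∈ Finset.univ.erase k)
        (· ∈ Finset.univ.erase (3 : Fin 4)) :=
    (mvPolynomialX (Fin 4) (Fin 4) K).subperm_congr (fun i => by simp) (fun i => by simp)
  rw [hcongr, pderiv_subperm_X_mem _ _ (by simp) (by simp [hk.symm]), aeval_subperm_X]
  have hcols : ∀ i : Fin 4, i ∈ (Finset.univ.erase k).erase 0 ↔ i ∈ ({b, d} : Finset (Fin 4)) := by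
    intro i
    simp only [Finset.mem_erase, Finset.mem_univ, and_true, Finset.mem_insert,
      Finset.mem_singleton]
    constructor
    · rintro ⟨hi0, hik⟩
      have hi := i.isLt; have hk' := k.isLt; have hb' := b.isLt; have hd' := d.isLt
      simp only [ne_eq, Fin.ext_iff, Fin.val_zero] at hk hb hd hkb hkd hbd hi0 hik ⊢
      omega
    · rintro (rfl | rfl)
      · exact ⟨hb, hkb.symm⟩
      · exact ⟨hd, hkd.symm⟩
  have hrows : ∀ i : Fin 4, i ∈ (Finset.univ.erase (3 : Fin 4)).erase 0 ↔
      i ∈ ({1, 2} : Finset (Fin 4)) := by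
    intro i; fin_cases i <;> simp
  rw [(Matrix.of fun r c => _).subperm_congr hcols hrows,
    subperm_pair_pair _ (by decide : (1 : Fin 4) ≠ 2) hbd]
  simp

/-- `g(∂_{0k} ∂_{30} per_4) = g(x_{1b}) g(x_{2d}) + g(x_{1d}) g(x_{2b})` for `{k,b,d} = {1,2,3}`
(transposed position). [folklore] -/
theorem aeval_pderiv_pderiv_perPoly_eq_perm' {k b d : Fin 4} (hk : k ≠ 0) (hb : b ≠ 0) (hd : d ≠ 0)
    (hkb : k ≠ b) (hkd : k ≠ d) (hbd : b ≠ d) :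
    aeval g (pderiv (0, k) (pderiv (3, 0) (perPoly (Fin 4) K))) =
      g (1, b) * g (2, d) + g (1, d) * g (2, b) := by
  rw [pderiv_perPoly]
  have hcongr : (mvPolynomialX (Fin 4) (Fin 4) K).subperm (· ≠ (0 : Fin 4)) (· ≠ (3 : Fin 4)) =
      (mvPolynomialX (Fin 4) (Fin 4) K).subperm (· ∈ Finset.univ.erase (0 : Fin 4))
        (· ∈ Finset.univ.erase (3 : Fin 4)) :=
    (mvPolynomialX (Fin 4) (Fin 4) K).subperm_congr (fun i => by simp) (fun i => by simp)
  rw [hcongr, pderiv_subperm_X_mem _ _ (by simp) (by simp [hk]), aeval_subperm_X]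
  have hcols : ∀ i : Fin 4, i ∈ (Finset.univ.erase (0 : Fin 4)).erase k ↔
      i ∈ ({b, d} : Finset (Fin 4)) := by
    intro i
    simp only [Finset.mem_erase, Finset.mem_univ, and_true, Finset.mem_insert,
      Finset.mem_singleton]
    constructor
    · rintro ⟨hik, hi0⟩
      have hi := i.isLt; have hk' := k.isLt; have hb' := b.isLt; have hd' := d.isLt
      simp only [ne_eq, Fin.ext_iff, Fin.val_zero] at hk hb hd hkb hkd hbd hi0 hik ⊢
      omega
    · rintro (rfl | rfl)
      · exact ⟨hkb.symm, hb⟩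
      · exact ⟨hkd.symm, hd⟩
  have hrows : ∀ i : Fin 4, i ∈ (Finset.univ.erase (3 : Fin 4)).erase 0 ↔
      i ∈ ({1, 2} : Finset (Fin 4)) := by
    intro i; fin_cases i <;> simp
  rw [(Matrix.of fun r c => _).subperm_congr hcols hrows,
    subperm_pair_pair _ (by decide : (1 : Fin 4) ≠ 2) hbd]
  simp

end Substitution

end Summit.ValiantsHypothesis.LiftNullstellensatz

end
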